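import Literature.NumberTheory.IwasawaTheory.ClassicalMuInvariant
import HarnessLib

/-!
# The classical Iwasawa `λ`-invariant of a `ℤ_p`-extension, growth form

Topic `NumberTheory/IwasawaTheory` (sequel of `ClassicalMuInvariant.lean`, same namespace).  For a `ℤ_p`-extension
`κ : K_∞/K` with layers `K_n`, Iwasawa's theorem gives `e_n = ord_p h(K_n) = μ p^n + λ n + ν` for `n ≫ 0`
(Lang, *Cyclotomic Fields I–II*, Ch. 5 §1 Thm. 1.2; Washington, GTM 83, Thm. 13.13).  The tree types `μ = 0` in GROWTH
FORM as `ClassicalMuVanishes κ : ∃ l ν n₀, ∀ n ≥ n₀, e_n = l·n + ν` (nothing asserted).  This file NAMES the slope: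

* `classicalLambda κ : ℕ` — THE CLASSICAL `λ`-INVARIANT of `κ` when `μ = 0`: the (unique) `l` of the growth form;
  JUNK VALUE `0` when `ClassicalMuVanishes κ` fails (then no slope exists in this form; documented).  A DEFINITION, no fact.
* `classicalLambda_spec` (the growth form holds with slope `classicalLambda κ`), `eq_classicalLambda_of_growth` (ANY
  eventual growth law `e_n = l·n + ν` has `l = classicalLambda κ`: two affine functions of `n` that agree for all large `n`
  have the same slope — so the junk-free value is canonical), `classicalLambda_eq_zero_of_not_classicalMuVanishes`,
  `classicalLambda_eq_zero_of_eventually_const` (constant `p`-class numbers ⇒ `λ = 0`, e.g. Weber's `2 ∤ h(ℚ_n)`),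
  `classNumberPExp_succ_sub_eq_classicalLambda` (under `μ = 0`: `e_{n+1} − e_n = λ` for `n ≫ 0`).

Written for cell `bsd-2adic` (crux `OrdLambdaHalfAtTwo`, line `kato_determinant_greenberg_two`; pen ruling RC-382): the
meeting exponent `Q(D, N) = λ₂(ℚ(√−D)) − 1 + Σ_{ℓ ∣ N} 2^{ord₂(ℓ²−1)−2}` of that line is typed over `classicalLambda` of the
cyclotomic `ℤ₂`-extension of the imaginary quadratic field (Ferrero 1980 / Kida 1979 compute `λ₂(ℚ(√−D))`; the tree cites
the growth-form dictionary only).  What is NOT here: the unramified Iwasawa module `X_nr` and `λ(X_nr)` as a `Λ`-module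
invariant (the tree's `lambdaInvariant` is for `Λ`-modules; the identification `λ(X_nr) = classicalLambda κ` under `μ = 0`
is Iwasawa's theorem, not asserted); `μ` itself as a number.

References: [Lang1990] Ch. 5 §1 Thm. 1.2, §4; [Washington1997] §13.3 Thm. 13.13; [FerreroWashington1979] (μ = 0 for abelian
fields, the hypothesis under which `classicalLambda` is junk-free for every abelian `K`).
-/

noncomputable section

open scoped Classical

universe u

namespace Literature.NumberTheory.IwasawaTheory

open Literature.NumberTheory.EllipticCurves

variable {K : Type u} [Field K] {p : ℕ} [Fact p.Prime]

/-- **The classical Iwasawa `λ`-invariant of the `ℤ_p`-extension `κ` (growth form).**  If `ClassicalMuVanishes κ`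
(`∃ l ν n₀, ∀ n ≥ n₀, ord_p h(K_n) = l·n + ν`, i.e. `μ = 0`), this is that slope `l` — unique by
`eq_classicalLambda_of_growth` —, Iwasawa's `λ` in `e_n = λ n + ν` (Lang Ch. 5 §1 Thm. 1.2 with `m = 0`; Washington Thm. 13.13).
JUNK VALUE `0` when `μ ≠ 0` (no growth law of this shape exists).  A DEFINITION; nothing is asserted about any tower.
[cite: Lang1990, Ch. 5 §1 Thm. 1.2 (pp. 124–129)] -/
def classicalLambda (κ : ZpExtension K p) : ℕ :=
  if h : ClassicalMuVanishes κ then Classical.choose h else 0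

/-- The growth law with slope `classicalLambda κ`: under `μ = 0`, `e_n = λ·n + ν` for all `n ≥ n₀`.
[cite: Lang1990, Ch. 5 §1 Thm. 1.2 (pp. 124–129)] -/
theorem classicalLambda_spec (κ : ZpExtension K p) (h : ClassicalMuVanishes κ) :
    ∃ (ν : ℤ) (n₀ : ℕ), ∀ n, n₀ ≤ n → (classNumberPExp κ n : ℤ) = classicalLambda κ * n + ν := by
  rw [classicalLambda, dif_pos h]
  exact Classical.choose_spec h

/-- **Uniqueness of the slope**: any eventual growth law `e_n = l·n + ν` (`n ≥ n₀`) has `l = classicalLambda κ` — two affine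
functions of `n` agreeing for all large `n` have equal slopes (compare `n` and `n + 1`). So the value of `classicalLambda` does
not depend on the choice hidden in its definition. [cite: Washington1997, §13.3 Thm. 13.13] -/
theorem eq_classicalLambda_of_growth (κ : ZpExtension K p) {l : ℕ} {ν : ℤ} {n₀ : ℕ}
    (h : ∀ n, n₀ ≤ n → (classNumberPExp κ n : ℤ) = l * n + ν) : l = classicalLambda κ := by
  have hμ : ClassicalMuVanishes κ := ⟨l, ν, n₀, h⟩
  obtain ⟨ν', n₁, h'⟩ := classicalLambda_spec κ hμ
  set N := max n₀ n₁ with hN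
  have h1 := h N (le_max_left _ _)
  have h2 := h (N + 1) ((le_max_left _ _).trans (Nat.le_succ _))
  have h1' := h' N (le_max_right _ _)
  have h2' := h' (N + 1) ((le_max_right _ _).trans (Nat.le_succ _))
  -- subtract consecutive values: `e_{N+1} − e_N = l = λ`
  have key : (l : ℤ) = (classicalLambda κ : ℤ) := by
    have e1 : (classNumberPExp κ (N + 1) : ℤ) - classNumberPExp κ N = l := by rw [h2, h1]; push_cast; ring
    have e2 : (classNumberPExp κ (N + 1) : ℤ) - classNumberPExp κ N = classicalLambda κ := by rw [h2', h1']; push_cast; ring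
    rw [← e1, e2]
  exact_mod_cast key

/-- Junk case: `classicalLambda κ = 0` when the growth form of `μ = 0` fails. [cite: Lang1990, Ch. 5 §1 Thm. 1.2 (pp. 124–129)] -/
theorem classicalLambda_eq_zero_of_not_classicalMuVanishes (κ : ZpExtension K p) (h : ¬ ClassicalMuVanishes κ) :
    classicalLambda κ = 0 := by
  rw [classicalLambda, dif_neg h]

/-- A tower with eventually CONSTANT `p`-class-number exponents has `λ = 0` (e.g. `2 ∤ h(ℚ_n)` for the cyclotomic
`ℤ₂`-extension of `ℚ`, Weber). [cite: Lang1990, Ch. 5 §4 Thm. 4.3] -/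
theorem classicalLambda_eq_zero_of_eventually_const (κ : ZpExtension K p) {c n₀ : ℕ}
    (h : ∀ n, n₀ ≤ n → classNumberPExp κ n = c) : classicalLambda κ = 0 :=
  (eq_classicalLambda_of_growth κ (l := 0) (ν := c) (n₀ := n₀) (fun n hn ↦ by simp [h n hn])).symm

/-- Under `μ = 0` the consecutive differences stabilise at `λ`: `e_{n+1} − e_n = classicalLambda κ` for all `n ≥ n₀`
(Iwasawa: «`e_{n+1} − e_n = λ` for `n ≫ 0` when `μ = 0`»). [cite: Washington1997, §13.3 Thm. 13.13] -/
theorem classNumberPExp_succ_sub_eq_classicalLambda (κ : ZpExtension K p) (h : ClassicalMuVanishes κ) :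
    ∃ n₀ : ℕ, ∀ n, n₀ ≤ n →
      (classNumberPExp κ (n + 1) : ℤ) - classNumberPExp κ n = classicalLambda κ := by
  obtain ⟨ν, n₀, h'⟩ := classicalLambda_spec κ h
  refine ⟨n₀, fun n hn ↦ ?_⟩
  rw [h' n hn, h' (n + 1) (hn.trans (Nat.le_succ _))]
  push_cast
  ring

end Literature.NumberTheory.IwasawaTheory

end
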